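import Summits.KontsevichZagierPeriods.KontsevichZagierPeriods.Theorems.TerasomaMultiplicationBetaCancellationStubTameFormAux9
import Summits.KontsevichZagierPeriods.KontsevichZagierPeriods.Theorems.TerasomaMultiplicationBetaCancellationStubTameFormAux10
import Mathlib.LinearAlgebra.Matrix.Permutation

/-!
# `BetaCancellation` (stmt-KontsevichZagierPeriods-13633), line `divisor-slicing-transshipment` — stub `stub_tameForm`, auxiliary file 13: coordinate permutations and scaling of the last coordinate

Two one-piece finite piecewise measure isomorphisms used to absorb spectators into catalytic
cylinders:

* `MIso.perm` — a permutation `π` of the coordinates of `ℝᴺ`, `Ψ z = z ∘ π`, is a one-piece `MIso`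
  from `(S, ρ)` onto `({w | w ∘ π⁻¹ ∈ S}, ρ (· ∘ π⁻¹))`: it is linear with `|det| = 1`
  (`Matrix.det_permutation`);
* `MIso.scaleLast` — over a `ℚ`-semialgebraic base `B ⊆ ℝᵐ` and for a polynomial-like factor
  `β > 0` (semialgebraic and differentiable on `ℝᵐ`), `(y, s) ↦ (y, β y · s)` is a one-piece `MIso`
  from `(B × (0,1), ρ₀ (y))` onto `({(y, s) | y ∈ B, 0 < s < β y}, ρ₀ (y) / β y)`
  (`exists_affinePiece`).

References: M. Kontsevich, D. Zagier, *Periods* (2001), §1.2 rule (2); crux NOTES c6 (F13).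
-/

noncomputable section

-- `Summit.KontsevichZagierPeriods.KontsevichZagierPeriods.…` is the tree's mandated layout (single-conjunct summit).
set_option linter.dupNamespace false

namespace Summit.KontsevichZagierPeriods.KontsevichZagierPeriods.BetaCancellationDivisorSlicing

open MeasureTheory Set Function
open Literature.NumberTheory.Transcendental
open Literature.NumberTheory.Transcendental.KZ
open Literature.ModelTheory.ExponentialFields (IsSemialgebraic isSemialgebraic_univ)

variable {N m : ℕ}

/-! ### Coordinate permutations -/

/-- The coordinate permutation `w ↦ w ∘ π` as a continuous linear map. [folklore] -/
theorem permCLM_apply (π : Equiv.Perm (Fin N)) (w : Fin N → ℝ) :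
    (ContinuousLinearMap.pi fun i : Fin N => ContinuousLinearMap.proj (R := ℝ)
      (φ := fun _ : Fin N => ℝ) (π i)) w = w ∘ π :=
  rfl

/-- **A coordinate permutation has determinant `±1`.** [folklore] -/
theorem abs_det_permCLM (π : Equiv.Perm (Fin N)) :
    |(ContinuousLinearMap.pi fun i : Fin N => ContinuousLinearMap.proj (R := ℝ)
      (φ := fun _ : Fin N => ℝ) (π i)).det| = 1 := by
  have h : ((ContinuousLinearMap.pi fun i : Fin N => ContinuousLinearMap.proj (R := ℝ)
      (φ := fun _ : Fin N => ℝ) (π i)) : (Fin N → ℝ) →ₗ[ℝ] (Fin N → ℝ)) =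
      Matrix.toLin' (π.permMatrix ℝ) := by
    refine LinearMap.ext fun w => ?_
    rw [Matrix.toLin'_apply, Matrix.permMatrix_mulVec]
    rfl
  rw [ContinuousLinearMap.det, h, LinearMap.det_toLin', Matrix.det_permutation, abs_unit_intCast]

/-- **Coordinate permutations are one-piece `MIso`s.** [folklore] -/
theorem MIso.perm (π : Equiv.Perm (Fin N)) {S : Set (Fin N → ℝ)} (hS : IsSemialgebraic ℚ S)
    (ρ : (Fin N → ℝ) → ℝ) :
    Nonempty (MIso N (fun _ : Unit => S) (fun _ => ρ)
      (fun _ : Unit => {w : Fin N → ℝ | w ∘ π.symm ∈ S}) (fun _ w => ρ (w ∘ π.symm))) := by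
  have hT : IsSemialgebraic ℚ {w : Fin N → ℝ | w ∘ π.symm ∈ S} := hS.preimage_comp π.symm
  have hinv : ∀ z : Fin N → ℝ, (z ∘ π) ∘ π.symm = z := fun z => by
    funext i; simp
  have hinv' : ∀ w : Fin N → ℝ, (w ∘ π.symm) ∘ π = w := fun w => by
    funext i; simp
  have himg : (fun z : Fin N → ℝ => z ∘ π) '' S = {w : Fin N → ℝ | w ∘ π.symm ∈ S} := by
    ext w
    simp only [mem_image, mem_setOf_eq]
    constructor
    · rintro ⟨z, hz, rfl⟩
      rw [hinv]; exact hz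
    · intro hw
      exact ⟨w ∘ π.symm, hw, hinv' w⟩
  refine MIso.single S (fun z => z ∘ π) (fun _ => ContinuousLinearMap.pi fun i : Fin N =>
      ContinuousLinearMap.proj (R := ℝ) (φ := fun _ : Fin N => ℝ) (π i)) hS subset_rfl ?_ ?_ ?_
    himg.subset (fun z _ => by rw [abs_det_permCLM, mul_one, hinv]) (by simp) (by rw [himg]; simp)
  · exact IsSemialgebraicMapOn.of_forall hS fun j =>
      (isSemialgebraicFunOn_apply hS (π j)).congr fun z _ => rfl
  · intro z _ z' _ h
    have := congrArg (fun w : Fin N → ℝ => w ∘ π.symm) h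
    simpa only [hinv] using this
  · intro z _
    exact ((ContinuousLinearMap.pi fun i : Fin N => ContinuousLinearMap.proj (R := ℝ)
      (φ := fun _ : Fin N => ℝ) (π i)).hasFDerivAt).hasFDerivWithinAt

/-! ### Scaling the last coordinate -/

/-- **Scaling the last coordinate is a one-piece `MIso`**: over a `ℚ`-semialgebraic base `B ⊆ ℝᵐ`,
for `β` `ℚ`-semialgebraic on `B`, differentiable on `ℝᵐ` and positive on `B`,
`(B × (0,1), ρ₀ (init)) ≅ ({(y, s) | y ∈ B, 0 < s < β y}, ρ₀ (init) / β (init))` along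
`(y, s) ↦ (y, β y · s)`. [cite: KontsevichZagier2001, §1.2 rule (2)] -/
theorem MIso.scaleLast {B : Set (Fin m → ℝ)} (hB : IsSemialgebraic ℚ B) {β : (Fin m → ℝ) → ℝ}
    (hβ : IsSemialgebraicFunOn ℚ B β) (hβd : Differentiable ℝ β) (hβpos : ∀ y ∈ B, 0 < β y)
    (ρ₀ : (Fin m → ℝ) → ℝ) :
    Nonempty (MIso (m + 1)
      (fun _ : Unit => {z : Fin (m + 1) → ℝ | (Fin.init z : Fin m → ℝ) ∈ B ∧ 0 < z (Fin.last m) ∧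
        z (Fin.last m) < 1}) (fun _ z => ρ₀ (Fin.init z))
      (fun _ : Unit => {z : Fin (m + 1) → ℝ | (Fin.init z : Fin m → ℝ) ∈ B ∧ 0 < z (Fin.last m) ∧
        z (Fin.last m) < β (Fin.init z)}) (fun _ z => ρ₀ (Fin.init z) / β (Fin.init z))) := by
  have hzero : IsSemialgebraicFunOn ℚ B (fun _ => (0 : ℝ)) := by
    simpa using isSemialgebraicFunOn_aeval hB (0 : MvPolynomial (Fin m) ℚ)
  have hone : IsSemialgebraicFunOn ℚ B (fun _ => (1 : ℝ)) := by
    simpa using isSemialgebraicFunOn_aeval hB (1 : MvPolynomial (Fin m) ℚ)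
  obtain ⟨Ψ', hP, hsa, hinj, hder, hdet, himg⟩ := exists_affinePiece isOpen_univ (subset_univ B) hB
    hzero hβ (differentiableOn_const (0 : ℝ)) hβd.differentiableOn hβpos hzero hone
  have hP' : {z : Fin (m + 1) → ℝ | (Fin.init z : Fin m → ℝ) ∈ B ∧ (fun _ => (0 : ℝ)) (Fin.init z) <
      z (Fin.last m) ∧ z (Fin.last m) < (fun _ => (1 : ℝ)) (Fin.init z)} =
      {z : Fin (m + 1) → ℝ | (Fin.init z : Fin m → ℝ) ∈ B ∧ 0 < z (Fin.last m) ∧ z (Fin.last m) < 1} := rfl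
  have himg' : (fun w : Fin (m + 1) → ℝ => (Fin.snoc (Fin.init w) ((fun _ => (0 : ℝ)) (Fin.init w) +
      β (Fin.init w) * w (Fin.last m)) : Fin (m + 1) → ℝ)) ''
      {z : Fin (m + 1) → ℝ | (Fin.init z : Fin m → ℝ) ∈ B ∧ 0 < z (Fin.last m) ∧ z (Fin.last m) < 1} =
      {z : Fin (m + 1) → ℝ | (Fin.init z : Fin m → ℝ) ∈ B ∧ 0 < z (Fin.last m) ∧
        z (Fin.last m) < β (Fin.init z)} := by
    rw [← hP', himg]
    ext z
    simp
  rw [hP'] at hP hsa hinj hder hdet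
  refine MIso.single _ _ Ψ' hP subset_rfl hsa hinj hder himg'.subset (fun z hz => ?_) (by simp)
    (by rw [himg']; simp)
  rw [hdet z hz, Fin.init_snoc, abs_of_pos (hβpos _ hz.1), div_mul_cancel₀ _ (hβpos _ hz.1).ne']

/-! ### Headline -/

/-- Registered helper goal of the stub `stub_tameForm`: coordinate permutations have Jacobian
determinant `±1`. [folklore] -/
theorem tameForm_aux_permDet : ∀ {N : ℕ} (π : Equiv.Perm (Fin N)), |(ContinuousLinearMap.pi fun i : Fin N => ContinuousLinearMap.proj (R := ℝ) (φ := fun _ : Fin N => ℝ) (π i)).det| = 1 :=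
  fun π => abs_det_permCLM π

end Summit.KontsevichZagierPeriods.KontsevichZagierPeriods.BetaCancellationDivisorSlicing

end
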